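import Summits.BirchSwinnertonDyer.Rank1Residual.Supersingular.KobayashiMainConjecture
import Literature.NumberTheory.EllipticCurves.Rank1Residual.Predicates
import Literature.NumberTheory.EllipticCurves.PAdicBSD
import Literature.NumberTheory.EllipticCurves.IwasawaAlgebraDivisibilityProofs
import Literature.NumberTheory.EllipticCurves.Kato2004.IwasawaCohomologyZetaLiftTwo
import Literature.NumberTheory.EllipticCurves.KatoFineSelmerDual
import Literature.NumberTheory.EllipticCurves.TateModuleContinuityProofs
import Literature.NumberTheory.EllipticCurves.TateModuleFreeProofs
import HarnessLib

/-!
# Route `ThetaPartnerAtTwo` (TP2), crux K3 `SignedKatoDivisibilityUpToAtTwo` (item stmt-BirchSwinnertonDyer-20308),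
# line `colemanrat` v3: the LENGTH ROAD — K3's local form off `2` from (C2) a `2`-adic Coleman/Poitou–Tate
# length inequality carrying a genuine `2`-adic Euler-system class and (K2) Kato's Euler-system bound Thm. 13.4 (2)
# at `p = 2` (lead `bsd-wall-tp2-p2x`)

HONEST FRAMING (cell `bsd-wall`): THEOREMS ONLY — no definition, no named fact, no instance, no `sorry`; the two
displayed hypotheses (C2), (K2) of §2 are the REGISTERED STUBS of the line (research at `p = 2`; (K2) is Kato's
printed Thm. 13.4 (2), whose tree transcription `Kato2004.thm13_4_lengthAt_fineSelmerDual_le_of_isEulerSystemClass`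
carries `p ≠ 2` because its Euler-system-class predicate corestricts `ℚ(μ_{p^{n+1}}) → ℚ_n`, which at `p = 2` must be
`ℚ(μ_{2^{n+2}}) → ℚ_n` — the tree's `Kato2004.levelToLayerTwo`); closes no item by itself; BSD is NOT proved by any
of this.

## What is proved

* §1 (module theory, any commutative ring `R`): the FOUR-TERM INEQUALITY of the Coleman road. For `Λ`-linear
  `H →ᶜ P →ʲ X →ᵏ Y` exact at `P` and at `X`, `c` injective, `P ↪ R` (an ideal-like submodule), and any `z ∈ H`:
  `ℓ_𝔭(X) + ℓ_𝔭(H/Rz) ≤ ℓ_𝔭(Y) + ℓ_𝔭(R/(c z))` at every prime `𝔭` (`fourTerm_lengthAt_le`). This is the `≤` half of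
  Kato's §17.13 identity (p. 280) ∕ the proof of Kobayashi's Thm. 7.4 (p. 13), with NO surjectivity of `k`, NO
  surjectivity of the Coleman map (`P ≤ R` arbitrary) and NO identification of `c z` with an `L`-function — the
  shape in which it survives at `p = 2` (where `Col⁺` need not be onto and Kato's `z` is integral only up to `2^a`).
* §2 (`p = 2`, K3's binders): `offTwo_of_colemanLengthTwo_of_katoBoundTwo` — the local form of K3 (file
  `…OffTwo`, `signedKatoDivisibilityUpToAtTwo_iff_offTwo`) from
  (C2) for every habitat datum, dual datum `D` of `Sel⁺(E/ℚ_∞)` and height-one `𝔭 ∌ 2`: SOME pinned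
       `𝐇¹_Γ(T₂E)`-datum `I`, fine dual datum `Y`, and GENUINE `2`-adic Euler-system class `s ∈ 𝐇¹_Γ(T₂E)`
       (`proj_n s = Cor_{ℚ(μ_{2^{n+2}})/ℚ_n}(z_{n+2,∅})` for an integral Euler system `z` — the `p = 2` spelling of
       `Kato2004.IsEulerSystemClass`), `s ≠ 0`, with `ℓ_𝔭(𝐇¹/Λs) < ⊤` and
       `ℓ_𝔭(X⁺) + ℓ_𝔭(𝐇¹/Λs) ≤ ℓ_𝔭(X₀) + ℓ_𝔭(Λ/(L♭))` — Kobayashi (7.21) + Thm. 6.3 ∕ Sprung 2012 Def. 6.1 + §7.2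
       AT `p = 2`, in lengths off `2` (§1 is how it follows from a Coleman package);
  (K2) for every such `I`, `Y`, non-zero genuine `2`-adic Euler-system class `s` and height-one `𝔭 ∌ 2`:
       `ℓ_𝔭(X₀(E/ℚ_∞)) ≤ ℓ_𝔭(𝐇¹_Γ(T₂E)/Λs)` — Kato Thm. 13.4 (2) at `p = 2` (hypothesis (v) holds for non-CM `E`:
       tree theorem `Kato2004.exists_finrank_coker_eq_one_of_not_hasCM`, any `p`);
  (K3 BY NAME then follows by `SignedKatoOffTwo.signedKatoDivisibilityUpToAtTwo_of_offTwo` of the sibling file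
  `…OffTwo`; this file is ROUTE-INDEPENDENT — no `Theses` import — so that the registered skeleton composes the two).

References: [Kobayashi2003] Thm. 6.3 (p. 11), Thm. 7.3 (7.21) and proof of Thm. 7.4 (p. 13); [Kato2004Asterisque]
§12.2 (p. 220), Thm. 12.5 (p. 222), §13.1, Ex. 13.3, Thm. 13.4 (pp. 224–226), §17.13 (p. 280); [Sprung2012] Def. 6.1
(p. 1495: at `p = 2`, `z^± ∈ H¹_Iw(T) ⊗ ℚ`), Remark 6.16 (p. 1499), §7 (p. 1499: "From now on, assume p is odd");
[Washington1997] §13.1–13.2.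
-/

set_option autoImplicit false
-- the Theorems namespace of this sub repeats the summit name by design (D-0017 nested layout)
set_option linter.dupNamespace false

noncomputable section

open scoped Classical MatrixGroups ModularForm NumberField

open CongruenceSubgroup WeierstrassCurve Field IsDedekindDomain
  Literature.NumberTheory.GaloisRepresentations
  Literature.NumberTheory.EllipticCurves Literature.NumberTheory.EllipticCurves.ModularForms
  Literature.NumberTheory.EllipticCurves.Module Literature.NumberTheory.EllipticCurves.Rank1Residual
  Literature.NumberTheory.EllipticCurves.Kobayashi2003 Literature.NumberTheory.EllipticCurves.Kato2004
  Literature.NumberTheory.EllipticCurves.Kato2004.EulerSystemValues ZpExtension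
  Summit.BirchSwinnertonDyer.Rank1Residual.Supersingular

namespace Summit.BirchSwinnertonDyer.BirchSwinnertonDyer.Theorems

namespace SignedKatoOffTwo

/-! ## §1 The four-term inequality of the Coleman road (any commutative ring) -/

section FourTerm

variable {R : Type*} [CommRing R] {H P X Y : Type*} [AddCommGroup H] [_root_.Module R H]
  [AddCommGroup P] [_root_.Module R P] [AddCommGroup X] [_root_.Module R X]
  [AddCommGroup Y] [_root_.Module R Y]

/-- `ℓ_𝔭(P/c(Z)) = ℓ_𝔭(H/Z) + ℓ_𝔭(P/range c)` for an INJECTIVE `c : H → P` and a submodule `Z ≤ H` (the map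
`H → P/c(Z)` has kernel `Z` and cokernel `P/range c`). [folklore] -/
theorem lengthAt_quotient_map_eq_add (c : H →ₗ[R] P) (hc : Function.Injective c)
    (Z : Submodule R H) (𝔭 : PrimeSpectrum R) :
    lengthAt R (P ⧸ Submodule.map c Z) 𝔭 =
      lengthAt R (H ⧸ Z) 𝔭 + lengthAt R (P ⧸ LinearMap.range c) 𝔭 := by
  set M : Submodule R P := Submodule.map c Z with hM
  let φ : H →ₗ[R] P ⧸ M := M.mkQ ∘ₗ c
  have hkerφ : LinearMap.ker φ = Z := by
    rw [LinearMap.ker_comp, Submodule.ker_mkQ, hM, Submodule.comap_map_eq_of_injective hc]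
  have hrangeφ : LinearMap.range φ = (LinearMap.range c).map M.mkQ := LinearMap.range_comp _ _
  have hMle : M ≤ LinearMap.range c := by
    rw [hM, LinearMap.range_eq_map]; exact Submodule.map_mono le_top
  rw [lengthAt_eq_add_quotient (LinearMap.range φ) 𝔭]
  congr 1
  · rw [← lengthAt_eq_of_linearEquiv φ.quotKerEquivRange 𝔭,
      lengthAt_eq_of_linearEquiv (Submodule.quotEquivOfEq _ _ hkerφ) 𝔭]
  · rw [lengthAt_eq_of_linearEquiv (Submodule.quotEquivOfEq _ _ hrangeφ) 𝔭,
      lengthAt_eq_of_linearEquiv (Submodule.quotientQuotientEquivQuotient M (LinearMap.range c) hMle) 𝔭]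

/-- **The four-term inequality.** For `R`-linear `H →ᶜ P →ʲ X →ᵏ Y` exact at `P` (`ker j = range c`) and at
`X` (`ker k = range j`), with `c` injective and `ι : P ↪ R` injective, and any `z ∈ H`:
`ℓ_𝔭(X) + ℓ_𝔭(H/Rz) ≤ ℓ_𝔭(Y) + ℓ_𝔭(R/(ι(c z)))` at every prime `𝔭` (in `ℕ∞`, no finiteness needed).
Proof: `ℓ(X) = ℓ(P/range c) + ℓ(X/range j)`, `ℓ(X/range j) = ℓ(range k) ≤ ℓ(Y)`,
`ℓ(P/range c) + ℓ(H/Rz) = ℓ(P/c(Rz))` (`c` injective) and `P/c(Rz) ↪ R/(ι c z)` (`ι` injective).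
The `≤` half of Kato's §17.13 length identity ∕ of the proof of Kobayashi's Thm. 7.4, without surjectivity
of `k` or of the Coleman map. [cite: Kato2004Asterisque, §17.13 (p. 280)] [cite: Kobayashi2003, proof of Thm. 7.4 (p. 13)] -/
theorem fourTerm_lengthAt_le (ι : P →ₗ[R] R) (hι : Function.Injective ι) (c : H →ₗ[R] P)
    (hc : Function.Injective c) (j : P →ₗ[R] X) (k : X →ₗ[R] Y) (hcj : Function.Exact c j)
    (hjk : Function.Exact j k) (z : H) (𝔭 : PrimeSpectrum R) :
    lengthAt R X 𝔭 + lengthAt R (H ⧸ Submodule.span R {z}) 𝔭 ≤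
      lengthAt R Y 𝔭 + lengthAt R (R ⧸ Ideal.span {ι (c z)}) 𝔭 := by
  -- `ℓ(X) = ℓ(range j) + ℓ(X / range j)`
  have hX : lengthAt R X 𝔭 =
      lengthAt R (LinearMap.range j) 𝔭 + lengthAt R (X ⧸ LinearMap.range j) 𝔭 :=
    lengthAt_eq_add_quotient (LinearMap.range j) 𝔭
  -- `ℓ(X / range j) ≤ ℓ(Y)`: `X / ker k ≅ range k ≤ Y`
  have h1 : lengthAt R (X ⧸ LinearMap.range j) 𝔭 ≤ lengthAt R Y 𝔭 := by
    have hker : LinearMap.ker k = LinearMap.range j := LinearMap.exact_iff.mp hjk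
    rw [← lengthAt_eq_of_linearEquiv (Submodule.quotEquivOfEq _ _ hker) 𝔭,
      lengthAt_eq_of_linearEquiv k.quotKerEquivRange 𝔭]
    exact lengthAt_submodule_le _ 𝔭
  -- `ℓ(range j) = ℓ(P / range c)`: `range j ≅ P / ker j = P / range c`
  have h2 : lengthAt R (LinearMap.range j) 𝔭 = lengthAt R (P ⧸ LinearMap.range c) 𝔭 := by
    have hker : LinearMap.ker j = LinearMap.range c := LinearMap.exact_iff.mp hcj
    rw [← lengthAt_eq_of_linearEquiv j.quotKerEquivRange 𝔭,
      lengthAt_eq_of_linearEquiv (Submodule.quotEquivOfEq _ _ hker) 𝔭]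
  -- `ℓ(P / range c) + ℓ(H / Rz) = ℓ(P / c(Rz))`
  have h3 : lengthAt R (P ⧸ LinearMap.range c) 𝔭 + lengthAt R (H ⧸ Submodule.span R {z}) 𝔭 =
      lengthAt R (P ⧸ Submodule.map c (Submodule.span R {z})) 𝔭 := by
    rw [lengthAt_quotient_map_eq_add c hc _ 𝔭, add_comm]
  -- `P / c(Rz) ↪ R / (ι c z)`
  have h4 : lengthAt R (P ⧸ Submodule.map c (Submodule.span R {z})) 𝔭 ≤
      lengthAt R (R ⧸ Ideal.span {ι (c z)}) 𝔭 := by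
    let ψ : (P ⧸ Submodule.map c (Submodule.span R {z})) →ₗ[R] R ⧸ Ideal.span {ι (c z)} :=
      (Submodule.map c (Submodule.span R {z})).liftQ ((Ideal.span {ι (c z)}).mkQ ∘ₗ ι) (by
        rw [LinearMap.ker_comp, Submodule.ker_mkQ, Submodule.map_span, Set.image_singleton,
          Submodule.span_singleton_le_iff_mem, Submodule.mem_comap]
        exact Ideal.subset_span rfl)
    refine lengthAt_le_of_injective ψ ?_ 𝔭
    rw [← LinearMap.ker_eq_bot, eq_bot_iff]
    intro x hx
    induction x using Submodule.Quotient.induction_on with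
    | H y =>
      rw [Submodule.mem_bot, Submodule.Quotient.mk_eq_zero, Submodule.map_span, Set.image_singleton]
      have hy : (Ideal.span {ι (c z)}).mkQ (ι y) = 0 := by
        simpa [ψ] using hx
      rw [Submodule.mkQ_apply, Submodule.Quotient.mk_eq_zero, Ideal.mem_span_singleton'] at hy
      obtain ⟨a, ha⟩ := hy
      have hya : y = a • c z := hι (by rw [map_smul, smul_eq_mul, ha])
      rw [hya]
      exact Submodule.smul_mem _ a (Submodule.subset_span rfl)
  calc lengthAt R X 𝔭 + lengthAt R (H ⧸ Submodule.span R {z}) 𝔭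
      = lengthAt R (X ⧸ LinearMap.range j) 𝔭 +
          (lengthAt R (P ⧸ LinearMap.range c) 𝔭 + lengthAt R (H ⧸ Submodule.span R {z}) 𝔭) := by
        rw [hX, h2]; ring
    _ ≤ lengthAt R Y 𝔭 + lengthAt R (R ⧸ Ideal.span {ι (c z)}) 𝔭 := by
        rw [h3]; exact add_le_add h1 h4

/-- **The four-term inequality needs only HALF of each exactness** (appended, lead tp2-p2x g0): for `R`-linear
`H →ᶜ P →ʲ X →ᵏ Y` with `c` injective, `ι : P ↪ R` injective, the COMPLEX property `j ∘ c = 0` (at `P`: only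
`range c ≤ ker j`) and the COVER property `ker k ≤ range j` (at `X`: only this inclusion), and any `z ∈ H`:
`ℓ_𝔭(X) + ℓ_𝔭(H/Rz) ≤ ℓ_𝔭(Y) + ℓ_𝔭(R/(ι(c z)))`. Proof: `ℓ(X) = ℓ(range j) + ℓ(X/range j)`, `ℓ(X/range j) ≤ ℓ(X/ker k) =
ℓ(range k) ≤ ℓ(Y)` (cover), `ℓ(range j) = ℓ(P/ker j) ≤ ℓ(P/range c)` (complex), `ℓ(P/range c) + ℓ(H/Rz) = ℓ(P/c(Rz))
≤ ℓ(R/(ι c z))`. For Kobayashi's (7.21) this means: the UPPER bound on `X^ε` uses only «global classes die in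
`(Sel^ε/Sel⁰)^∨`» (reciprocity) and «`ker(X^ε → X₀)` is covered by the local quotient» (the definition of `Sel⁰`
inside `Sel^ε` + local duality) — NOT the deep half of Poitou–Tate (`ker j ≤ range c`).
[cite: Kato2004Asterisque, §17.13 (p. 280)] [cite: Kobayashi2003, (7.17)–(7.21) and proof of Thm. 7.4 (pp. 12–13)] -/
theorem fourTerm_lengthAt_le_of_comp_eq_zero (ι : P →ₗ[R] R) (hι : Function.Injective ι) (c : H →ₗ[R] P)
    (hc : Function.Injective c) (j : P →ₗ[R] X) (k : X →ₗ[R] Y) (hcj : ∀ x, j (c x) = 0)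
    (hjk : LinearMap.ker k ≤ LinearMap.range j) (z : H) (𝔭 : PrimeSpectrum R) :
    lengthAt R X 𝔭 + lengthAt R (H ⧸ Submodule.span R {z}) 𝔭 ≤
      lengthAt R Y 𝔭 + lengthAt R (R ⧸ Ideal.span {ι (c z)}) 𝔭 := by
  -- `ℓ(X) = ℓ(range j) + ℓ(X / range j)`
  have hX : lengthAt R X 𝔭 =
      lengthAt R (LinearMap.range j) 𝔭 + lengthAt R (X ⧸ LinearMap.range j) 𝔭 :=
    lengthAt_eq_add_quotient (LinearMap.range j) 𝔭
  -- cover: `ℓ(X / range j) ≤ ℓ(X / ker k) = ℓ(range k) ≤ ℓ(Y)`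
  have h1 : lengthAt R (X ⧸ LinearMap.range j) 𝔭 ≤ lengthAt R Y 𝔭 := by
    have hsurj : Function.Surjective
        ((LinearMap.ker k).mapQ (LinearMap.range j) LinearMap.id hjk) := by
      intro q
      induction q using Submodule.Quotient.induction_on with
      | H x => exact ⟨Submodule.Quotient.mk x, rfl⟩
    refine (lengthAt_le_of_surjective _ hsurj 𝔭).trans ?_
    rw [lengthAt_eq_of_linearEquiv k.quotKerEquivRange 𝔭]
    exact lengthAt_submodule_le _ 𝔭
  -- complex: `ℓ(range j) = ℓ(P / ker j) ≤ ℓ(P / range c)`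
  have h2 : lengthAt R (LinearMap.range j) 𝔭 ≤ lengthAt R (P ⧸ LinearMap.range c) 𝔭 := by
    have hle : LinearMap.range c ≤ LinearMap.ker j := by
      rintro _ ⟨x, rfl⟩
      exact hcj x
    have hsurj : Function.Surjective
        ((LinearMap.range c).mapQ (LinearMap.ker j) LinearMap.id hle) := by
      intro q
      induction q using Submodule.Quotient.induction_on with
      | H x => exact ⟨Submodule.Quotient.mk x, rfl⟩
    rw [← lengthAt_eq_of_linearEquiv j.quotKerEquivRange 𝔭]
    exact lengthAt_le_of_surjective _ hsurj 𝔭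
  -- `ℓ(P / range c) + ℓ(H / Rz) = ℓ(P / c(Rz))`
  have h3 : lengthAt R (P ⧸ LinearMap.range c) 𝔭 + lengthAt R (H ⧸ Submodule.span R {z}) 𝔭 =
      lengthAt R (P ⧸ Submodule.map c (Submodule.span R {z})) 𝔭 := by
    rw [lengthAt_quotient_map_eq_add c hc _ 𝔭, add_comm]
  -- `P / c(Rz) ↪ R / (ι c z)`
  have h4 : lengthAt R (P ⧸ Submodule.map c (Submodule.span R {z})) 𝔭 ≤
      lengthAt R (R ⧸ Ideal.span {ι (c z)}) 𝔭 := by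
    let ψ : (P ⧸ Submodule.map c (Submodule.span R {z})) →ₗ[R] R ⧸ Ideal.span {ι (c z)} :=
      (Submodule.map c (Submodule.span R {z})).liftQ ((Ideal.span {ι (c z)}).mkQ ∘ₗ ι) (by
        rw [LinearMap.ker_comp, Submodule.ker_mkQ, Submodule.map_span, Set.image_singleton,
          Submodule.span_singleton_le_iff_mem, Submodule.mem_comap]
        exact Ideal.subset_span rfl)
    refine lengthAt_le_of_injective ψ ?_ 𝔭
    rw [← LinearMap.ker_eq_bot, eq_bot_iff]
    intro x hx
    induction x using Submodule.Quotient.induction_on with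
    | H y =>
      rw [Submodule.mem_bot, Submodule.Quotient.mk_eq_zero, Submodule.map_span, Set.image_singleton]
      have hy : (Ideal.span {ι (c z)}).mkQ (ι y) = 0 := by
        simpa [ψ] using hx
      rw [Submodule.mkQ_apply, Submodule.Quotient.mk_eq_zero, Ideal.mem_span_singleton'] at hy
      obtain ⟨a, ha⟩ := hy
      have hya : y = a • c z := hι (by rw [map_smul, smul_eq_mul, ha])
      rw [hya]
      exact Submodule.smul_mem _ a (Submodule.subset_span rfl)
  calc lengthAt R X 𝔭 + lengthAt R (H ⧸ Submodule.span R {z}) 𝔭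
      = lengthAt R (LinearMap.range j) 𝔭 +
          (lengthAt R (X ⧸ LinearMap.range j) 𝔭 + lengthAt R (H ⧸ Submodule.span R {z}) 𝔭) := by
        rw [hX]; ring
    _ ≤ lengthAt R (P ⧸ LinearMap.range c) 𝔭 +
          (lengthAt R Y 𝔭 + lengthAt R (H ⧸ Submodule.span R {z}) 𝔭) :=
        add_le_add h2 (add_le_add h1 le_rfl)
    _ = lengthAt R Y 𝔭 +
          (lengthAt R (P ⧸ LinearMap.range c) 𝔭 + lengthAt R (H ⧸ Submodule.span R {z}) 𝔭) := by ring
    _ ≤ lengthAt R Y 𝔭 + lengthAt R (R ⧸ Ideal.span {ι (c z)}) 𝔭 := by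
        rw [h3]; exact add_le_add le_rfl h4

end FourTerm

/-! ## §2 K3's local form off `2` from (C2) + (K2) at `p = 2` -/

section AtTwo

/-- **The LENGTH ROAD at `p = 2`: K3's local form off `2` from (C2) + (K2).** (C2) = for every habitat datum,
dual datum `D` of `Sel⁺(E/ℚ_∞)` (torsion) and height-one `𝔭 ∌ 2`, some pinned `I`, `Y` and a non-zero GENUINE
`2`-adic Euler-system class `s ∈ 𝐇¹_Γ(T₂E)` with `ℓ_𝔭(𝐇¹/Λs) < ⊤` and the four-term inequality
`ℓ_𝔭(X⁺) + ℓ_𝔭(𝐇¹/Λs) ≤ ℓ_𝔭(X₀) + ℓ_𝔭(Λ/(L♭))` (Kobayashi (7.21) + Thm. 6.3 ∕ Sprung 2012 Def. 6.1, §7.2 at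
`p = 2`, via `fourTerm_lengthAt_le`); (K2) = Kato Thm. 13.4 (2) at `p = 2`: `ℓ_𝔭(X₀) ≤ ℓ_𝔭(𝐇¹/Λs)` for every
non-zero genuine `2`-adic Euler-system class `s` of a non-CM curve. Then `ℓ_𝔭(X⁺) ≤ ℓ_𝔭(Λ/(L♭))` (cancel the
finite `ℓ_𝔭(𝐇¹/Λs)`). The structure facts of `T₂E` are instance binders of the hypotheses, discharged here by
`TateModule.continuousSMul_padicInt`, `module_free_tateModule_holds`, `module_finite_tateModule_holds`.
[cite: Kobayashi2003, Thm. 7.3 (7.21) and proof of Thm. 7.4 (p. 13)] [cite: Kato2004Asterisque, Thm. 13.4 (2) (p. 226)]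
[cite: Sprung2012, Def. 6.1 (p. 1495) and §7 (p. 1499)] -/
theorem offTwo_of_colemanLengthTwo_of_katoBoundTwo
    (hC2 : ∀ (W : WeierstrassCurve ℚ) [W.IsElliptic] [W.IsGloballyMinimal],
      ¬ W.HasCM → W.analyticRank = 0 → GoodSS W 2 → W.frobeniusTrace 2 = 0 →
      ∀ (κ : ZpExtension ℚ 2) (γ : Field.absoluteGaloisGroup ℚ) (hκ : κ.IsCyclotomic),
        κ.IsTopGenerator γ → IsCyclotomicVariable 2 γ →
        ∀ [NeZero (W.conductorNorm ℤ)] (f : CuspForm (Gamma0 (W.conductorNorm ℤ)) 2),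
          IsNewformOf W f → ∀ (ϖ : ℚ), (ϖ : ℝ) * W.realPeriodRat = plusPeriod f →
        ∀ (Lplus Lminus : IwasawaAlgebra 2), IsPollackPair f 2 Lplus Lminus →
        ∀ (D : SignedSelmerDualData W κ γ 1) [ContinuousSMul ℤ_[2] (W.tateModule 2)]
          [Module.Free ℤ_[2] (W.tateModule 2)] [Module.Finite ℤ_[2] (W.tateModule 2)],
          Module.IsTorsion (IwasawaAlgebra 2) D.X →
          ∀ 𝔭 : PrimeSpectrum (IwasawaAlgebra 2), 𝔭.asIdeal.height = 1 →
            PowerSeries.C (2 : ℤ_[2]) ∉ 𝔭.asIdeal →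
          ∃ (I : Kato2004.IwasawaH1Data W 2 κ γ) (Y : W.FineSelmerDualData κ γ) (s : I.H),
            (∃ (S : Set (HeightOneSpectrum (𝓞 ℚ))) (_ : S.Finite)
                (z : ∀ (k : ℕ) (r : (cyclotomicLevelsRat 2 S).Ideals),
                  H1 (tateRep W 2) ((cyclotomicLevelsRat 2 S).level k r.1)),
                IsEulerSystem (cyclotomicLevelsRat 2 S) (tateRep W 2) 2 z ∧
                (∀ (k : ℕ) (r : (cyclotomicLevelsRat 2 S).Ideals),
                  z k r ∈ integralH1 (tateRep W 2) 2 ((cyclotomicLevelsRat 2 S).level k r.1)) ∧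
                ∀ n : ℕ, I.proj n s =
                  Kato2004.levelToLayerTwo W hκ S n (z (n + 2) (cyclotomicLevelsRat 2 S).idealOne)) ∧
            s ≠ 0 ∧
            lengthAt (IwasawaAlgebra 2) (I.H ⧸ Submodule.span (IwasawaAlgebra 2) {s}) 𝔭 ≠ ⊤ ∧
            lengthAt (IwasawaAlgebra 2) D.X 𝔭 +
                lengthAt (IwasawaAlgebra 2) (I.H ⧸ Submodule.span (IwasawaAlgebra 2) {s}) 𝔭 ≤
              lengthAt (IwasawaAlgebra 2) Y.X 𝔭 +
                lengthAt (IwasawaAlgebra 2) (IwasawaAlgebra 2 ⧸ Ideal.span {kobayashiL 1 Lplus Lminus}) 𝔭)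
    (hK2 : ∀ (W : WeierstrassCurve ℚ) [W.IsElliptic], ¬ W.HasCM →
      ∀ [ContinuousSMul ℤ_[2] (W.tateModule 2)] [Module.Free ℤ_[2] (W.tateModule 2)]
        [Module.Finite ℤ_[2] (W.tateModule 2)]
        (κ : ZpExtension ℚ 2) (γ : Field.absoluteGaloisGroup ℚ) (hκ : κ.IsCyclotomic), κ.IsTopGenerator γ →
      ∀ (I : Kato2004.IwasawaH1Data W 2 κ γ) (Y : W.FineSelmerDualData κ γ) (s : I.H),
        (∃ (S : Set (HeightOneSpectrum (𝓞 ℚ))) (_ : S.Finite)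
            (z : ∀ (k : ℕ) (r : (cyclotomicLevelsRat 2 S).Ideals),
              H1 (tateRep W 2) ((cyclotomicLevelsRat 2 S).level k r.1)),
            IsEulerSystem (cyclotomicLevelsRat 2 S) (tateRep W 2) 2 z ∧
            (∀ (k : ℕ) (r : (cyclotomicLevelsRat 2 S).Ideals),
              z k r ∈ integralH1 (tateRep W 2) 2 ((cyclotomicLevelsRat 2 S).level k r.1)) ∧
            ∀ n : ℕ, I.proj n s =
              Kato2004.levelToLayerTwo W hκ S n (z (n + 2) (cyclotomicLevelsRat 2 S).idealOne)) →
        s ≠ 0 →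
        ∀ 𝔭 : PrimeSpectrum (IwasawaAlgebra 2), 𝔭.asIdeal.height = 1 →
          PowerSeries.C (2 : ℤ_[2]) ∉ 𝔭.asIdeal →
          lengthAt (IwasawaAlgebra 2) Y.X 𝔭 ≤
            lengthAt (IwasawaAlgebra 2) (I.H ⧸ Submodule.span (IwasawaAlgebra 2) {s}) 𝔭) :
    ∀ (W : WeierstrassCurve ℚ) [W.IsElliptic] [W.IsGloballyMinimal],
      ¬ W.HasCM → W.analyticRank = 0 → GoodSS W 2 → W.frobeniusTrace 2 = 0 →
      ∀ (κ : ZpExtension ℚ 2) (γ : Field.absoluteGaloisGroup ℚ),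
        κ.IsCyclotomic → κ.IsTopGenerator γ → IsCyclotomicVariable 2 γ →
        ∀ [NeZero (W.conductorNorm ℤ)] (f : CuspForm (Gamma0 (W.conductorNorm ℤ)) 2),
          IsNewformOf W f → ∀ (ϖ : ℚ), (ϖ : ℝ) * W.realPeriodRat = plusPeriod f →
        ∀ (Lplus Lminus : IwasawaAlgebra 2), IsPollackPair f 2 Lplus Lminus →
        ∀ (D : SignedSelmerDualData W κ γ 1), Module.IsTorsion (IwasawaAlgebra 2) D.X →
          ∀ 𝔭 : PrimeSpectrum (IwasawaAlgebra 2), 𝔭.asIdeal.height = 1 →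
            PowerSeries.C (2 : ℤ_[2]) ∉ 𝔭.asIdeal →
            lengthAt (IwasawaAlgebra 2) D.X 𝔭 ≤
              lengthAt (IwasawaAlgebra 2) (IwasawaAlgebra 2 ⧸ Ideal.span {kobayashiL 1 Lplus Lminus}) 𝔭 := by
  intro W _ _ hcm hr hss ha κ γ hκ hγ hcv _ f hf ϖ hϖ Lplus Lminus hPP D hX 𝔭 h𝔭 hp𝔭
  haveI : ContinuousSMul ℤ_[2] (W.tateModule 2) := TateModule.continuousSMul_padicInt
  haveI : Module.Free ℤ_[2] (W.tateModule 2) := module_free_tateModule_holds W 2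
  haveI : Module.Finite ℤ_[2] (W.tateModule 2) := module_finite_tateModule_holds W 2
  obtain ⟨I, Y, s, hES, hs0, hfin, h4⟩ :=
    hC2 W hcm hr hss ha κ γ hκ hγ hcv f hf ϖ hϖ Lplus Lminus hPP D hX 𝔭 h𝔭 hp𝔭
  have hK := hK2 W hcm κ γ hκ hγ I Y s hES hs0 𝔭 h𝔭 hp𝔭
  have h : lengthAt (IwasawaAlgebra 2) D.X 𝔭 +
        lengthAt (IwasawaAlgebra 2) (I.H ⧸ Submodule.span (IwasawaAlgebra 2) {s}) 𝔭 ≤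
      lengthAt (IwasawaAlgebra 2) (IwasawaAlgebra 2 ⧸ Ideal.span {kobayashiL 1 Lplus Lminus}) 𝔭 +
        lengthAt (IwasawaAlgebra 2) (I.H ⧸ Submodule.span (IwasawaAlgebra 2) {s}) 𝔭 :=
    h4.trans ((add_le_add hK le_rfl).trans (le_of_eq (add_comm _ _)))
  exact (WithTop.add_le_add_iff_right hfin).mp h

end AtTwo

end SignedKatoOffTwo

end Summit.BirchSwinnertonDyer.BirchSwinnertonDyer.Theorems

end
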